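import Summits.Ventures.LatticeQCDFlow.Scoring.ChainLagProductCLT
import Summits.Ventures.LatticeQCDFlow.Scoring.MadrasSokalRatioCLT

/-!
# THE FIXED-WINDOW LAW OF `τ̂_W` FOR MARKOV-CHAIN DATA: along a chain with a Doeblin power, from EVERY
# initial law, `√N (τ̂_W(N) − τ_W) ⇒ ⟪ℓ, Z⟫ ∼ N(0, σ²_ℓ)`, `σ²_ℓ` the Green–Kubo variance of the
# influence series `Σ_t ℓ_t f̄(X_i) f̄(X_{i+t})`

HONEST FRAMING: exact (Metropolis-corrected) sampling algorithms for lattice gauge theory;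
figures of merit are autocorrelation/cost numbers at stated couplings and volumes; no
continuum-physics claim.

Venture `LatticeQCDFlow` (cell pub-lqcd), sub-topic `Scoring`; FANOUT row 16 (`su2-base`), GEN-9.
NEW WORK of the cell, not a published result; no definition is introduced; nothing is cited as a fact
(the delta method on the joint law of sample autocovariances — Bartlett 1946, Priestley 1981 §5.3,
Anderson 1971 §8.4 — NAMED ONLY).  THE GAP NAMED IN GEN-8's `Scoring/ChainMadrasSokalDataWindow`
('a CLT for `τ̂` on chain data … the fixed-window law of `τ̂_W` for chains is not typed') and in row 13's
`Exactness/NCMCGeneralSpaceTauIntWindowConsistency` (consistency only): the MARKOV-CHAIN counterpart of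
GEN-7's `Scoring/MadrasSokalRatioCLT.tendstoInDistribution_tauIntWindow` (which is for finite-range
functionals of an i.i.d. sequence).  Data: a bounded observable `f` read along a chain with a Doeblin
power `(nHit κ m)(z, ·) ≥ ε ν`, from ANY initial law `μ₀` (row 16's heat-bath / HMC streams and every
exact sampler of the cell with such a certificate); statistic: the windowed ratio estimator
`τ̂_W(N) = ½ + Σ_{t=1}^{W} Γ̂_N(t)/Γ̂_N(0)` of the known-mean empirical autocovariances
`Γ̂_N(t) = (1/N) Σ_{i<N} f̄(X_i) f̄(X_{i+t})` (`Scoring.acovHat`, `f̄ = f − π f`), i.e. scorer A's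
`tau_int_W` / scorer B's `tauIntWindow` up to the mean-subtraction and `1/(N−t)` conventions; centring
`τ_W = tauIntWindow ρ W` with `ρ(t) = C(t)/C(0)`, `C(t) = Scoring.autocov κ π f̄ t`.  By the delta method
(row 4's `CardConsistency.tendstoInDistribution_deltaMethod_fderiv`, GEN-7's differentiability of the
ratio map `tauHatFn`) on GEN-9's joint CLT `Scoring/ChainLagProductCLT`:

* **`tendstoInDistribution_chain_tauIntWindow_of_nHit`** — THE THEOREM: `C(0) = Var_π f ≠ 0`; `Z` any
  random vector of `ℝ^{W+1}` with `⟪a, Z⟫ ∼ N(0, windowLRVar κ π W (lagProdComb f̄ W a))` for all `a`;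
  `ℓ = tauHatGrad W (C(t))_{t≤W}` (`ℓ_0 = −(Σ_{t=1}^W C(t))/C(0)²`, `ℓ_t = 1/C(0)`).  For EVERY initial
  law `μ₀`: `√N (τ̂_W(N) − τ_W) ⇒ ⟪ℓ, Z⟫` under `P_{μ₀}`;
* **`hasLaw_chain_tauIntWindow_limit`** — the limit law is `N(0, σ²_ℓ)` with
  `σ²_ℓ = windowLRVar κ π W (lagProdComb f̄ W ℓ)`: THE ASYMPTOTIC VARIANCE OF `τ̂_W` ON CHAIN DATA IS THE
  GREEN–KUBO (long-run) VARIANCE, UNDER `P_π`, OF THE INFLUENCE SERIES `ψ(Y_i) = Σ_t ℓ_t f̄(X_i) f̄(X_{i+t})`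
  — `E_π[ψ̄(Y_0)²] + 2 Σ_{k≥1} E_π[ψ̄(Y_0) ψ̄(Y_k)]`, no Gaussian / linear-process assumption.

NOT CLAIMED: the matrix (Bartlett-kernel) form of `σ²_ℓ` and the construction of `Z` (the variance
functional as a quadratic form — next file); the scorers' centred `1/(N−t)` statistic on chain data
(mean subtraction along a chain); data-chosen windows (GEN-8's transfer needs this law as input — docking
is a one-liner once the selector's consistency `ChainMadrasSokalDataWindow` is invoked); `σ²_ℓ > 0`; rates.
-/

noncomputable section

open MeasureTheory ProbabilityTheory Filter Finset Preorder WithLp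
open scoped ENNReal Topology RealInnerProductSpace
open Summit.Ventures.LatticeQCDFlow.Exactness Summit.Ventures.LatticeQCDFlow.Exactness.GeneralNCMC

namespace Summit.Ventures.LatticeQCDFlow.Scoring

variable {S : Type*} [MeasurableSpace S]

section ChainTauInt

variable (κ : Kernel S S) [IsMarkovKernel κ] {π : Measure S} [IsProbabilityMeasure π]
  {ν : Measure S} [IsProbabilityMeasure ν] {ε : ℝ≥0∞} {m : ℕ}

/-- **THE CENTRAL LIMIT THEOREM FOR THE WINDOWED `τ_int` ESTIMATOR ON MARKOV-CHAIN DATA, FROM ANY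
INITIAL LAW.**  `κ` Markov with invariant probability `π`, `(nHit κ m)(z, ·) ≥ ε ν` for all `z`
(`ε ≠ 0`, `0 < m`); `|f| ≤ C` measurable, `f̄ = f − ∫ f dπ`, `C(t) = autocov κ π f̄ t` with `C(0) ≠ 0`;
`Γ̂_N(t) = acovHat (f̄ ∘ X) N t`; `Z` a random vector with `⟪a, Z⟫ ∼ N(0, windowLRVar κ π W (lagProdComb f̄ W a))`;
`ℓ = tauHatGrad W (C(t))_t`.  Then for EVERY initial law `μ₀`, under `P_{μ₀}`:
`√N (tauIntWindow (Γ̂_N(·)/Γ̂_N(0)) W − tauIntWindow (C(·)/C(0)) W) ⇒ ⟪ℓ, Z⟫`. -/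
theorem tendstoInDistribution_chain_tauIntWindow_of_nHit (hπ : Kernel.Invariant κ π) (hε : ε ≠ 0)
    (hmin : ∀ z, ε • ν ≤ nHit κ m z) (hm : 0 < m)
    {f : S → ℝ} (hf : Measurable f) {C : ℝ} (hC : ∀ z, |f z| ≤ C) (W : ℕ)
    (hσ : autocov κ π (fun z => f z - ∫ z', f z' ∂π) 0 ≠ 0)
    (μ₀ : Measure S) [IsProbabilityMeasure μ₀]
    {Ω' : Type*} [MeasurableSpace Ω'] {P' : Measure Ω'} [IsProbabilityMeasure P']
    {Z : Ω' → EuclideanSpace ℝ (Fin (W + 1))} (hZm : AEMeasurable Z P')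
    (hZ : ∀ a : EuclideanSpace ℝ (Fin (W + 1)), HasLaw (fun ω' => ⟪a, Z ω'⟫)
      (gaussianReal 0 (windowLRVar κ π W (lagProdComb (fun z => f z - ∫ z', f z' ∂π) W a)).toNNReal) P')
    [IsProbabilityMeasure (Kernel.trajMeasure (X := fun _ : ℕ => S) μ₀
        (fun n : ℕ => κ.comap (fun hh : (i : ↥(Finset.Iic n)) → S => hh ⟨n, Finset.mem_Iic.2 le_rfl⟩)
          (measurable_pi_apply _)))] :
    TendstoInDistribution
      (fun (N : ℕ) (x : ℕ → S) => Real.sqrt N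
        * (tauIntWindow (fun t => acovHat (fun (i : ℕ) (x : ℕ → S) => f (x i) - ∫ z', f z' ∂π) N t x
              / acovHat (fun (i : ℕ) (x : ℕ → S) => f (x i) - ∫ z', f z' ∂π) N 0 x) W
          - tauIntWindow (fun t => autocov κ π (fun z => f z - ∫ z', f z' ∂π) t
              / autocov κ π (fun z => f z - ∫ z', f z' ∂π) 0) W))
      atTop (fun ω' => ⟪tauHatGrad W (toLp 2 fun t : Fin (W + 1) =>
        autocov κ π (fun z => f z - ∫ z', f z' ∂π) t), Z ω'⟫)
      (fun _ => Kernel.trajMeasure (X := fun _ : ℕ => S) μ₀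
        (fun n : ℕ => κ.comap (fun hh : (i : ↥(Finset.Iic n)) → S => hh ⟨n, Finset.mem_Iic.2 le_rfl⟩)
          (measurable_pi_apply _))) P' := by
  set P := Kernel.trajMeasure (X := fun _ : ℕ => S) μ₀
    (fun n : ℕ => κ.comap (fun hh : (i : ↥(Finset.Iic n)) → S => hh ⟨n, Finset.mem_Iic.2 le_rfl⟩)
      (measurable_pi_apply _)) with hP
  set fb : S → ℝ := fun z => f z - ∫ z', f z' ∂π with hfb
  have hfbm : Measurable fb := hf.sub measurable_const
  set cvec : EuclideanSpace ℝ (Fin (W + 1)) := toLp 2 fun t : Fin (W + 1) => autocov κ π fb t with hcvec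
  set T : ℕ → (ℕ → S) → EuclideanSpace ℝ (Fin (W + 1)) :=
    fun N x => toLp 2 fun t : Fin (W + 1) => acovHat (fun (i : ℕ) (x : ℕ → S) => fb (x i)) N t x with hT
  have hclt : TendstoInDistribution (fun (N : ℕ) x => Real.sqrt N • (T N x - cvec)) atTop Z
      (fun _ => P) P' :=
    tendstoInDistribution_chain_acovHat_of_nHit κ hπ hε hmin hm hf hC W μ₀ hZm hZ
  have hXm : ∀ i : ℕ, Measurable fun x : ℕ → S => fb (x i) := fun i => hfbm.comp (measurable_pi_apply i)
  have hAm : ∀ N t : ℕ, Measurable (acovHat (fun (i : ℕ) (x : ℕ → S) => fb (x i)) N t) := fun N t => by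
    unfold acovHat
    exact (Finset.measurable_sum _ fun i _ => (hXm i).mul (hXm (i + t))).div_const _
  have hTm : ∀ N, AEMeasurable (T N) P := fun N => by
    have h : Measurable (T N) :=
      (WithLp.measurable_toLp 2 _).comp (measurable_pi_lambda _ fun t => hAm N t)
    exact h.aemeasurable
  have hc0 : cvec 0 ≠ 0 := hσ
  have hD := CardConsistency.tendstoInDistribution_deltaMethod_fderiv
    (a := fun N : ℕ => Real.sqrt N) (Real.tendsto_sqrt_atTop.comp tendsto_natCast_atTop_atTop)
    hclt hTm (hasFDerivAt_tauHatFn cvec hc0) (measurable_tauHatFn W)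
  refine hD.congr (fun N => Eventually.of_forall fun x => ?_) (Eventually.of_forall fun ω' => ?_)
  · rw [smul_eq_mul, hT, hcvec,
      tauHatFn_toLp (fun t => acovHat (fun (i : ℕ) (x : ℕ → S) => fb (x i)) N t x),
      tauHatFn_toLp (fun t => autocov κ π fb t)]
  · exact tauHatDeriv_apply cvec (Z ω')

omit [IsProbabilityMeasure π] in
/-- **THE LIMIT LAW: `⟪ℓ, Z⟫ ∼ N(0, σ²_ℓ)`, `σ²_ℓ = windowLRVar κ π W (lagProdComb f̄ W ℓ)`** — the
Green–Kubo variance under `P_π` of the influence series `Σ_t ℓ_t f̄(X_i) f̄(X_{i+t})` (read off the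
hypothesis on `Z` at `a = ℓ`). -/
theorem hasLaw_chain_tauIntWindow_limit {W : ℕ} {g : S → ℝ}
    {Ω' : Type*} [MeasurableSpace Ω'] {P' : Measure Ω'}
    {Z : Ω' → EuclideanSpace ℝ (Fin (W + 1))}
    (hZ : ∀ a : EuclideanSpace ℝ (Fin (W + 1)), HasLaw (fun ω' => ⟪a, Z ω'⟫)
      (gaussianReal 0 (windowLRVar κ π W (lagProdComb g W a)).toNNReal) P')
    (c : EuclideanSpace ℝ (Fin (W + 1))) :
    HasLaw (fun ω' => ⟪tauHatGrad W c, Z ω'⟫)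
      (gaussianReal 0 (windowLRVar κ π W (lagProdComb g W (tauHatGrad W c))).toNNReal) P' :=
  hZ (tauHatGrad W c)

end ChainTauInt

end Summit.Ventures.LatticeQCDFlow.Scoring

end
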